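import Summits.Langlands.Langlands.Statement
import Literature.NumberTheory.GaloisRepresentations.FramedGaloisRepInduce
import Literature.NumberTheory.GaloisRepresentations.FrobeniusPlaces
import Literature.NumberTheory.GaloisRepresentations.ResidualPairIntegrality
import Literature.NumberTheory.Automorphic.AutomorphicRepsGLSatakeFlathProofs
import HarnessLib

/-!
# The Satake data of an avatar of `Ind_L^K ρ` are `μ_p`-stable at the inert places
# (crux `AscentConjugationSolvable`, stmt-Langlands-1094; piece `CyclicPrimeAscent`; lead c3 helper stub H6)

Support file (closes nothing).  Let `L/K` be a Galois extension of number fields of PRIME degree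
`p = [L:K]`, `ρ : Γ_L → GL_n(ℚ̄_ℓ)` a framed Galois representation unramified at all but finitely
many places, and `P` an automorphic representation of `GL_{pn}(𝔸_K)` which is Satake–Frobenius
compatible with the induced representation `Ind_{Γ_L}^{Γ_K} ρ` (`FramedGaloisRep.induce`) at all
but finitely many places (`SatakeFrobCompatibleAt`, L-normalisation: the arithmetic Frobenius at
`v` has roots `ι⁻¹(a⁻¹)`, `a ∈ t_{P,v}`).  Then at all but finitely many places `v` of `K`, for
every place `w ∣ v` of `L` of residue degree `p` (i.e. `v` INERT in `L`), every Satake parameter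
`α` of `P` at `v` is stable under multiplication by every primitive `p`-th root of unity — the
hypothesis of `Literature.NumberTheory.Automorphic.ArthurClozel1989_automorphicInduction_of_selfTwist`
(Arthur–Clozel, Ch. 3, Thm. 6.2 and its proof, (6.2)/(6.6): `AI(π) ⊗ η ≅ AI(π)`).

Proof (Galois side of Arthur–Clozel Ch. 3 §6; Neukirch VII (10.4) (iv)).  At all but finitely many
`v` the induced representation has Frobenius characteristic polynomial
`∏_{w ∣ v} Q_w(X^{f(w|v)})` (`FramedGaloisRep.eventually_hasFrobCharpolyAt_induce`, `Q_w` the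
Frobenius polynomial of `ρ` at `w`, which exists at the unramified places,
`FramedGaloisRep.IsUnramifiedAt.exists_hasFrobCharpolyAt`), and `v` is unramified in `L`
(`finite_setOf_not_isUnramifiedIn`).  If some `w ∣ v` has `f(w|v) = p`, then `w` is the only place
above `v` (prime degree dichotomy, `placesOver_dichotomy_of_prime`), so this polynomial is
`Q_w(X^p)`; by uniqueness of Frobenius polynomials (`FramedGaloisRep.HasFrobCharpolyAt.unique`) and
of Satake parameters (`AutomorphicRepData.hasSatakeParamAt_unique_holds`) it equals
`arithFrobPolyOfSatake ι q_v 1 α = ∏_{a ∈ α} (X - ι⁻¹(a⁻¹))`.  The root multiset of a polynomial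
of the shape `G(X^p)` is stable under multiplication by every `c` with `c^p = 1`
(`G(X^p)` is invariant under `X ↦ cX`; Mathlib `Polynomial.map_roots_comp_C_mul_X_add_C`), and
with `c = ι⁻¹(ζ⁻¹)` this is `α ↦ ζ · α` read through the injective map `a ↦ ι⁻¹(a⁻¹)`.

References: J. Arthur, L. Clozel, *Simple algebras, base change, and the advanced theory of the
trace formula*, Ann. of Math. Stud. 120 (1989), Ch. 3 §6 (Thm. 6.2, (6.2), (6.6); induced Hecke
matrices p. 183–184); J. Neukirch, *Algebraic Number Theory* (1999), Ch. I (9.3), Ch. VII (10.4).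
-/

noncomputable section

set_option linter.dupNamespace false -- project-wide option; `Summit.Langlands.Langlands` is the mandated namespace

namespace Summit.Langlands.Langlands.Theorems.SmithKummerSeedCyclicPrimeAscent

open scoped MatrixGroups NumberField Classical Matrix Polynomial
open Filter IsDedekindDomain Field Polynomial
open Literature.NumberTheory.Automorphic Literature.NumberTheory.GaloisRepresentations
  Literature.NumberTheory.PAdicHodge
open Summit.Langlands

/-! ## Roots of `G(X^p)` are `μ_p`-stable -/

/-- **The root multiset of `G(X^p)` is stable under multiplication by the `p`-th roots of unity**
(over a domain, counted with multiplicity): `G(X^p)` is invariant under the substitution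
`X ↦ c X` when `c^p = 1`, and the roots of `R(cX)` are `c⁻¹ ·` the roots of `R`
(Mathlib `Polynomial.map_roots_comp_C_mul_X_add_C`). [folklore] -/
private theorem roots_comp_X_pow_map_mul {F : Type*} [CommRing F] [IsDomain F] {p : ℕ}
    (hp : p ≠ 0) {c : F} (hc : c ^ p = 1) (G : F[X]) :
    (G.comp (X ^ p)).roots.map (c * ·) = (G.comp (X ^ p)).roots := by
  have hcomp : (G.comp (X ^ p)).comp (C c * X + C 0) = G.comp (X ^ p) := by
    rw [comp_assoc, X_pow_comp, C_0, add_zero, mul_pow, ← C_pow, hc, C_1, one_mul]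
  have h := map_roots_comp_C_mul_X_add_C (G.comp (X ^ p)) c 0 (IsUnit.of_pow_eq_one hc hp)
  rw [hcomp] at h
  simpa only [add_zero] using h

/-! ## Registered sub-goal form (crux stmt-Langlands-1094, line `registered`, stub H6) -/

/-- HELPER STUB H6 — **the Satake data of an avatar of `Ind_L^K ρ` are `μ_p`-stable at the inert places** (the
hypothesis of `ArthurClozel1989_automorphicInduction_of_selfTwist`): at a place `v` inert in `L` (one `w ∣ v`,
`f = p`) the Frobenius polynomial of `Ind ρ` is `Q_w(X^p)` (`hasFrobCharpolyAt_induce`), whose root multiset is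
stable under the `p`-th roots of unity; read back on `α` through `arithFrobPolyOfSatake ι q_v 1 α`.
[cite: ArthurClozelAMS120, Ch. 3, proof of Thm. 6.2 ((6.2), (6.6))] -/
theorem selfTwistStable_of_compatible_induce : ∀ (K L : Type) [Field K] [NumberField K] [Field L] [NumberField L] [Algebra K L] [IsGalois K L], (Module.finrank K L).Prime → ∀ (n : ℕ) (ℓ : ℕ) [Fact ℓ.Prime] (ι : PadicAlgCl ℓ ≃+* ℂ) (ρ : Literature.NumberTheory.GaloisRepresentations.FramedGaloisRep L (PadicAlgCl ℓ) n), (∀ᶠ w : IsDedekindDomain.HeightOneSpectrum (NumberField.RingOfIntegers L) in Filter.cofinite, ρ.IsUnramifiedAt w) → ∀ (hK : Literature.NumberTheory.Automorphic.isCompact_glFiniteIntegralLevel (Module.finrank K L * n) K) (P : Literature.NumberTheory.Automorphic.AutomorphicRepData (Literature.NumberTheory.Automorphic.AutomorphyDatum.gl (Module.finrank K L * n) K hK)), (∀ᶠ v : IsDedekindDomain.HeightOneSpectrum (NumberField.RingOfIntegers K) in Filter.cofinite, SatakeFrobCompatibleAt ι P (ρ.induce K (rfl : Module.finrank K L = Module.finrank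 K L)) v) → ∀ᶠ v : IsDedekindDomain.HeightOneSpectrum (NumberField.RingOfIntegers K) in Filter.cofinite, ∀ (w : IsDedekindDomain.HeightOneSpectrum (NumberField.RingOfIntegers L)) (α : Multiset ℂ), w.asIdeal.under (NumberField.RingOfIntegers K) = v.asIdeal → w.asIdeal.inertiaDeg (NumberField.RingOfIntegers K) = Module.finrank K L → P.HasSatakeParamAt v α → ∀ ζ : ℂ, IsPrimitiveRoot ζ (Module.finrank K L) → α.map (ζ * ·) = α := by
  intro K L _ _ _ _ _ _ hp n ℓ _ ι ρ hρ hK P hcompat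
  -- Frobenius polynomials `Q w` of `ρ` at its unramified places
  have hQex : ∀ w : HeightOneSpectrum (𝓞 L), ∃ Q : (PadicAlgCl ℓ)[X],
      ρ.IsUnramifiedAt w → ρ.HasFrobCharpolyAt w Q := fun w => by
    by_cases h : ρ.IsUnramifiedAt w
    · obtain ⟨Q, hQ⟩ := h.exists_hasFrobCharpolyAt
      exact ⟨Q, fun _ => hQ⟩
    · exact ⟨0, fun h' => absurd h' h⟩
  choose Q hQ using hQex
  -- `Ind ρ` has Frobenius polynomial `∏_{w ∣ v} Q_w(X^{f(w|v)})` a.e.; `v` is unramified in `L` a.e.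
  have hind : ∀ᶠ v : HeightOneSpectrum (𝓞 K) in cofinite,
      (ρ.induce K (rfl : Module.finrank K L = Module.finrank K L)).HasFrobCharpolyAt v
        (inducedFrobPolynomial v Q) :=
    FramedGaloisRep.eventually_hasFrobCharpolyAt_induce K rfl ρ (hρ.mono fun w hw => hQ w hw)
  have hunrL : ∀ᶠ v : HeightOneSpectrum (𝓞 K) in cofinite,
      Algebra.IsUnramifiedIn (𝓞 L) v.asIdeal :=
    eventually_cofinite.mpr (finite_setOf_not_isUnramifiedIn K L)
  filter_upwards [hcompat, hind, hunrL] with v hv hvind hunr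
  intro w α hwv hf hα ζ hζ
  obtain ⟨α₀, hα₀, -, hcp⟩ := hv
  obtain rfl : α = α₀ := P.hasSatakeParamAt_unique_holds hα hα₀
  -- `w` is the only place of `L` above `v`
  have hwv' : w.under (𝓞 K) = v := HeightOneSpectrum.ext hwv
  have hone : Nat.card {w' : HeightOneSpectrum (𝓞 L) // w'.under (𝓞 K) = v} = 1 := by
    rcases placesOver_dichotomy_of_prime hp hunr with ⟨-, h1⟩ | ⟨h1, -⟩
    · exact absurd (hf.symm.trans (h1 w hwv')) hp.one_lt.ne'
    · exact h1
  have hS : {w' : HeightOneSpectrum (𝓞 L) | w'.asIdeal.under (𝓞 K) = v.asIdeal} = {w} := by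
    ext w'
    simp only [Set.mem_setOf_eq, Set.mem_singleton_iff]
    refine ⟨fun hw' => ?_, fun hw' => hw' ▸ hwv⟩
    have hsub := (Nat.card_eq_one_iff_unique.mp hone).1
    exact congrArg Subtype.val (hsub.elim ⟨w', HeightOneSpectrum.ext hw'⟩ ⟨w, hwv'⟩)
  have hpoly : inducedFrobPolynomial v Q = (Q w).comp (X ^ Module.finrank K L) := by
    rw [inducedFrobPolynomial_def, hS, finprod_mem_singleton, hf]
  -- uniqueness of Frobenius polynomials: `∏_{a ∈ α} (X - ι⁻¹(a⁻¹)) = Q_w(X^p)`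
  have hR := FramedGaloisRep.HasFrobCharpolyAt.unique hcp hvind
  rw [hpoly] at hR
  -- the roots `ι⁻¹(a⁻¹)`, `a ∈ α`, are stable under `c = ι⁻¹(ζ⁻¹)`, `c ^ p = 1`
  have hginj : Function.Injective (fun a : ℂ => ι.symm a⁻¹) := fun a b hab => by
    simpa using hab
  have hroots : (arithFrobPolyOfSatake ι v.residueCard 1 α).roots =
      α.map (fun a : ℂ => ι.symm a⁻¹) := by
    rw [roots_arithFrobPolyOfSatake]
    refine Multiset.map_congr rfl fun a _ => ?_
    simp
  have hc : (ι.symm ζ⁻¹) ^ Module.finrank K L = 1 := by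
    rw [← map_pow, inv_pow, hζ.pow_eq_one, inv_one, map_one]
  have hstab : (α.map (fun a : ℂ => ι.symm a⁻¹)).map (ι.symm ζ⁻¹ * ·) =
      α.map (fun a : ℂ => ι.symm a⁻¹) := by
    rw [← hroots, hR]
    exact roots_comp_X_pow_map_mul hp.ne_zero hc (Q w)
  -- read back on `α` through the injective `a ↦ ι⁻¹(a⁻¹)`
  refine Multiset.map_injective hginj ?_
  have hcomp : ((fun a : ℂ => ι.symm a⁻¹) ∘ fun a : ℂ => ζ * a) =
      (fun b : PadicAlgCl ℓ => ι.symm ζ⁻¹ * b) ∘ fun a : ℂ => ι.symm a⁻¹ := by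
    funext a
    simp only [Function.comp_apply, mul_inv, map_mul]
  change (α.map fun a : ℂ => ζ * a).map (fun a : ℂ => ι.symm a⁻¹) = α.map (fun a : ℂ => ι.symm a⁻¹)
  rw [Multiset.map_map, hcomp, ← Multiset.map_map, hstab]

end Summit.Langlands.Langlands.Theorems.SmithKummerSeedCyclicPrimeAscent

end
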